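import Mathlib
import Summits.NavierStokesRegularity.NavierStokesRegularity.Theses.FilamentSkeletonRss

/-!
# Route FilamentSkeletonRss — support item `CoreAreaNecessity`

The necessity half of the 2001 core-area transport law: if the axial similarity velocity `w`
vanishes at `τs` and the similarity-frame Burgers balance `w A′ = (3/2 − w′) A + 4` holds there with
`A(τs) > 0`, then `w′(τs) > 3/2` and `A(τs) = 4 / (w′(τs) − 3/2)`.  Pure algebra: at `τs` the
left-hand side vanishes, so `(w′ − 3/2) A = 4 > 0` with `A > 0`.
-/

set_option linter.dupNamespace false

namespace Summit.NavierStokesRegularity.NavierStokesRegularity.Theorems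

/-- **CoreAreaNecessity** (route `FilamentSkeletonRss`, support item
stmt-NavierStokesRegularity-15404): at a stagnation point `τs` of `w` where the Burgers balance
`w A′ = (3/2 − w′) A + 4` holds with `A(τs) > 0`, necessarily `3/2 < w′(τs)` and
`A(τs) = 4 / (w′(τs) − 3/2)`. -/
theorem coreAreaNecessity_proof :
    Summit.NavierStokesRegularity.NavierStokesRegularity.Theses.FilamentSkeletonRss.CoreAreaNecessity := by
  intro w A τs hw hbal hA
  rw [hw, zero_mul] at hbal
  -- hbal : 0 = (3 / 2 - deriv w τs) * A τs + 4
  have hprod : (deriv w τs - 3 / 2) * A τs = 4 := by linarith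
  have hpos : 0 < deriv w τs - 3 / 2 := by
    by_contra h
    push Not at h
    nlinarith [mul_nonpos_of_nonpos_of_nonneg h hA.le]
  refine ⟨by linarith, ?_⟩
  rw [eq_div_iff hpos.ne', mul_comm]
  exact hprod

end Summit.NavierStokesRegularity.NavierStokesRegularity.Theorems
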